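/-
Copyright: the b2b-balaban T⁴-continuum CRUX team, row NE7b OWNER lineage `t4-ne7b-p1` (gen 138). Project licence.
-/
import Mathlib.Analysis.InnerProductSpace.PiL2
import Mathlib.Analysis.Calculus.FDeriv.Comp
import Mathlib.Analysis.Calculus.FDeriv.Linear
import Mathlib.Analysis.Normed.Operator.Bilinear

/-!
# THE RESCALING LETTER MAP: a LINEAR REPARAMETRISATION `U ↦ U ∘ A` of the `Y`-local nine-letter block class (the INPUT format
# of (399)–(407) ∕ (427)) by a continuous linear map `A : ℝ^{ι′} → ℝ^ι` (the next scale's field `v` injected into the current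
# one — block injection, interpolation, homothety; all at once) is again a member of the class, on the block `Y′ ⊆ ι′`, with
# EVERY letter transported by an EXPLICIT factor: the `Σ_Y`-format letters (`κ₀`, `Λ`, the growth letter) by the BLOCK
# TRANSFER constant `c` of `A` (`Σ_{x∈Y}(Av)_x² ≤ c·Σ_{y∈Y′}v_y²`), the operator letters by powers of `‖A‖` (`κ₂ ↦ ‖A‖²κ₂`,
# `κ₃ ↦ ‖A‖³κ₃`, `λ ↦ ‖A‖²λ`), the gradient letter by `‖A‖·max(1,c)` — SCOPING (d9)(1) of the owner's road: the bookkeeping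
# half of the rescaling step, composed with NOTHING (row NE7b, node U5c; Mathlib only; [folklore] chain rule)

Cell `pub-balaban`, sub-cell `t4`, spine estimate NE7b (`T4WeightBudget.RelWeightBound`; the cell's OWN estimate — NOT PRINTED in
[Bałaban 1983–89], NOT PROVED).  Crux-route work under `Spine/NE7b/` by the row OWNER (`t4-ne7b-p1` gen 138, file (428)) under FREEZE
(0)'s crux-prover clause; NOTHING of Bałaban's is named as a Lean object, valued or asserted; no `T4Continuum/Support` leaf typed; no
`def`, no notation; zero `sorry`.  Imports: Mathlib only (fast lane) — the class format is met BY SHAPE: the hypotheses below are the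
INPUT letters of (427) `…SupBlockClassReproduces` verbatim (`hUloc, hUd, hU'd, hU''d, hU₃c, hstab, hU'b, hU''b, hU₃b, hUup, hwup, hUsec`).

WHY (SCOPING-d9 (1), memo `t4/b2b-balaban-t4-ne7b-p1/g137/records/SCOPING-d9-class-closure.md`).  Gen 137 typed the FLUCTUATION half
of one renormalisation step as a self-map of the `Y`-local block class with the letter map
`(κ₀,κ₁,a,κ₂,κ₃,κu,au,Λ,λ) ↦ (λ+Λ∕2, 2λ+Λ, 1, 2(2λ+Λ), κ₃⁺, λ+Λ∕2, 0, Λ+2λ, 2λ+Λ)` (before rescaling).  To ITERATE, the output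
`w⁺ : ℝ^ι → ℝ` (a function of the background on the CURRENT lattice `ι`) must be read as a potential of the NEXT field
`v : ℝ^{ι′}` through the injection `A` of next-scale fields into current backgrounds (block-constant injection times the field
normalisation `L^{-[φ]}`, or a smoother interpolation): `U⁺ := w⁺ ∘ A`.  THIS FILE is that reading for an ARBITRARY continuous
linear `A`, letter by letter, with the two structure constants of `A` that matter: its BLOCK TRANSFER constant `c` from `Y′` to
`Y` and its operator norm `‖A‖`; plus the transport of `Y`-locality to `Y′`-locality when `A` is local (`v = v′` on `Y′ ⟹ Av = Av′`
on `Y`).  The canonical instance (block-constant injection of `n = L^d` sites per block, homothety `t`: `c = ‖A‖² = t²n`) and the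
fixed-ball test of the COMBINED map are the next files ((429), (430)); nothing is composed here.

WHAT IS PROVED ([folklore]; `A : EuclideanSpace ℝ ι′ →L[ℝ] EuclideanSpace ℝ ι`; the rescaled potential and its three derivative
maps are the λ-terms `fun v ↦ U (A v)`, `fun v ↦ (U′(Av)).comp A`, `fun v ↦ P_A.comp ((U″(Av)).comp A)`,
`fun v ↦ Ψ_A.comp ((U‴(Av)).comp A)` with the FIXED continuous linear maps `P_A := (compL ℝ ℝ^{ι′} ℝ^ι ℝ).flip A` (`f ↦ f ∘ A`) and
`Ψ_A := (compL ℝ ℝ^{ι′} (ℝ^ι →L ℝ) (ℝ^{ι′} →L ℝ) P_A) ∘L (compL ℝ ℝ^{ι′} ℝ^ι (ℝ^ι →L ℝ)).flip A` (`X ↦ P_A ∘ X ∘ A`) — written out):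
* §1 CLM ALGEBRA: `precomp_apply` (`P_A f = f.comp A`), `hess_apply` (`(P_A ∘ X ∘ A) h k = X (Ah) (Ak)`), `third_apply`
  (`(Ψ_A ∘ T ∘ A) h k l = T (Ah) (Ak) (Al)`), `norm_grad_le` (`‖f ∘ A‖ ≤ ‖A‖‖f‖`), `norm_hess_le` (`≤ ‖A‖²‖X‖`), `norm_third_le` (`≤ ‖A‖³‖T‖`).
* §2 CHAIN RULES: `hasFDerivAt_comp` (`U ∘ A`), `hasFDerivAt_grad_comp` (its derivative map), `hasFDerivAt_hess_comp` (its Hessian map),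
  `continuous_grad_comp`, `continuous_hess_comp`, `continuous_third_comp`.
* §3 BLOCK TRANSFER: `sum_sq_map_le` (`Σ_i (Az)_i² ≤ ‖A‖²·Σ_{i′} z_{i′}²`), `map_convex_comb` (`A((1−s)a + sb) = (1−s)Aa + sAb`).
* §4 THE LETTERS of `U ∘ A` on `Y′` from those of `U` on `Y`: `local_comp` (locality), `stab_comp` (`κ₀ ↦ cκ₀`), `grad_letter_comp`
  (`‖(U∘A)′v‖ ≤ ‖A‖κ₁(a + cΣ_{Y′}v²) ≤ ‖A‖κ₁max(1,c)·(a + Σ_{Y′}v²)`), `hess_letter_comp` (`κ₂ ↦ ‖A‖²κ₂`), `third_letter_comp` (`κ₃ ↦ ‖A‖³κ₃`),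
  `growth_comp` (`κu ↦ κu·max(1,c)`, `au ↦ au`), `upper_letter_comp` (`Λ ↦ cΛ`), `secant_letter_comp` (`λ ↦ ‖A‖²λ`).
* §5 THE END **`rescaled_class_structure`** (locality + `C³` block) and **`rescaled_class_letters`** (the seven inequality letters) — the
  input block of (427) for `U ∘ A` on `Y′`, assembled.
* §6 toy (kernel): `A = 0` kills every `Σ`-letter (`c = 0`).

HONEST (what this is NOT).  Pure bookkeeping: NO claim that any letter shrinks — that depends on `c` and `‖A‖` of the ACTUAL rescaling
(next files: for the canonical block-constant injection `c = ‖A‖² = t²·n ≥ 1` in every dimension at canonical field normalisation, so the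
`Σ`-letters are MASS-TYPE RELEVANT and GROW; the fixed-ball test of fluctuation ∘ rescaling is filed separately and is expected to be an
honest NO in this format).  The operator-norm letters ignore the locality of `U` inside `Y` (power counting with locality would give
`κ₃ ↦ L^{d−3[φ]}κ₃`, not `‖A‖³κ₃`) — located, not repaired.  (β3′) multi-block and (β4) extraction NOT touched; scalar skeleton ((A3),
NC-NE7b-α UNRULED); nothing of Bałaban's asserted.  BY-NAME EFFECT ON THE WALL: NONE.  NE7b NOT PRINTED ∕ NOT PROVED; spine PROVED 0∕9;
rung (B)+1 — the programme's measures remain FINITE-torus statements; NOT the mass gap, NOT Clay.  HONEST DEPENDENCY: continuum YM on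
T⁴ ⇐ BetaPertH ∧ nine spine estimates (0∕9 proved); BetaPertH ⇐ (D1) ∧ (D4) ∧ CAP+tail; G-an2-4 gates asym, D1 and NE2∕3∕4.
-/

set_option autoImplicit false
set_option maxSynthPendingDepth 3

noncomputable section

namespace Summit.QuantumFields.BalabanUV.T4Continuum.NE7b.SupBlockRescalingLetters

open Finset Real
open scoped BigOperators

variable {ι ι' : Type} [Fintype ι] [Fintype ι']

variable {A : EuclideanSpace ℝ ι' →L[ℝ] EuclideanSpace ℝ ι} {U : EuclideanSpace ℝ ι → ℝ}
  {U' : EuclideanSpace ℝ ι → EuclideanSpace ℝ ι →L[ℝ] ℝ} {U'' : EuclideanSpace ℝ ι → EuclideanSpace ℝ ι →L[ℝ] EuclideanSpace ℝ ι →L[ℝ] ℝ}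
  {U₃ : EuclideanSpace ℝ ι → EuclideanSpace ℝ ι →L[ℝ] EuclideanSpace ℝ ι →L[ℝ] EuclideanSpace ℝ ι →L[ℝ] ℝ}
  {κ₀ κ₁ κ₂ κ₃ κu a au Λ lam c : ℝ}

/-! ## §1. The algebra of pre-composition with `A` -/

/-- `P_A f = f ∘ A`: the fixed continuous linear map `(compL ℝ ℝ^{ι′} ℝ^ι ℝ).flip A` is pre-composition with `A` on covectors. [folklore] -/
@[simp]
theorem precomp_apply (A : EuclideanSpace ℝ ι' →L[ℝ] EuclideanSpace ℝ ι) (f : EuclideanSpace ℝ ι →L[ℝ] ℝ) :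
    ((ContinuousLinearMap.compL ℝ (EuclideanSpace ℝ ι') (EuclideanSpace ℝ ι) ℝ).flip A) f = f.comp A := by
  rw [ContinuousLinearMap.flip_apply, ContinuousLinearMap.compL_apply]

/-- The transported Hessian evaluates as `(P_A ∘ X ∘ A) h k = X (A h) (A k)`. [folklore] -/
@[simp]
theorem hess_apply (A : EuclideanSpace ℝ ι' →L[ℝ] EuclideanSpace ℝ ι) (X : EuclideanSpace ℝ ι →L[ℝ] EuclideanSpace ℝ ι →L[ℝ] ℝ)
    (h k : EuclideanSpace ℝ ι') :
    (((ContinuousLinearMap.compL ℝ (EuclideanSpace ℝ ι') (EuclideanSpace ℝ ι) ℝ).flip A).comp (X.comp A)) h k = X (A h) (A k) := by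
  rw [ContinuousLinearMap.comp_apply, ContinuousLinearMap.comp_apply, precomp_apply, ContinuousLinearMap.comp_apply]

/-- `Ψ_A X = P_A ∘ X ∘ A`: the fixed continuous linear map transporting bilinear forms. [folklore] -/
@[simp]
theorem hessTransport_apply (A : EuclideanSpace ℝ ι' →L[ℝ] EuclideanSpace ℝ ι) (X : EuclideanSpace ℝ ι →L[ℝ] EuclideanSpace ℝ ι →L[ℝ] ℝ) :
    ((ContinuousLinearMap.compL ℝ (EuclideanSpace ℝ ι') (EuclideanSpace ℝ ι →L[ℝ] ℝ) (EuclideanSpace ℝ ι' →L[ℝ] ℝ)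
        ((ContinuousLinearMap.compL ℝ (EuclideanSpace ℝ ι') (EuclideanSpace ℝ ι) ℝ).flip A)).comp
        ((ContinuousLinearMap.compL ℝ (EuclideanSpace ℝ ι') (EuclideanSpace ℝ ι) (EuclideanSpace ℝ ι →L[ℝ] ℝ)).flip A)) X =
      ((ContinuousLinearMap.compL ℝ (EuclideanSpace ℝ ι') (EuclideanSpace ℝ ι) ℝ).flip A).comp (X.comp A) := by
  rw [ContinuousLinearMap.comp_apply, ContinuousLinearMap.flip_apply, ContinuousLinearMap.compL_apply, ContinuousLinearMap.compL_apply]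

/-- The transported third derivative evaluates as `(Ψ_A ∘ T ∘ A) h k l = T (A h) (A k) (A l)`. [folklore] -/
@[simp]
theorem third_apply (A : EuclideanSpace ℝ ι' →L[ℝ] EuclideanSpace ℝ ι)
    (T : EuclideanSpace ℝ ι →L[ℝ] EuclideanSpace ℝ ι →L[ℝ] EuclideanSpace ℝ ι →L[ℝ] ℝ) (h k l : EuclideanSpace ℝ ι') :
    (((ContinuousLinearMap.compL ℝ (EuclideanSpace ℝ ι') (EuclideanSpace ℝ ι →L[ℝ] ℝ) (EuclideanSpace ℝ ι' →L[ℝ] ℝ)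
        ((ContinuousLinearMap.compL ℝ (EuclideanSpace ℝ ι') (EuclideanSpace ℝ ι) ℝ).flip A)).comp
        ((ContinuousLinearMap.compL ℝ (EuclideanSpace ℝ ι') (EuclideanSpace ℝ ι) (EuclideanSpace ℝ ι →L[ℝ] ℝ)).flip A)).comp (T.comp A)) h k l =
      T (A h) (A k) (A l) := by
  simp only [ContinuousLinearMap.comp_apply, ContinuousLinearMap.compL_apply, ContinuousLinearMap.flip_apply]

/-- `‖f ∘ A‖ ≤ ‖A‖·‖f‖`. [folklore] -/
theorem norm_grad_le (A : EuclideanSpace ℝ ι' →L[ℝ] EuclideanSpace ℝ ι) (f : EuclideanSpace ℝ ι →L[ℝ] ℝ) : ‖f.comp A‖ ≤ ‖A‖ * ‖f‖ := by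
  rw [mul_comm]
  exact f.opNorm_comp_le A

/-- `‖P_A ∘ X ∘ A‖ ≤ ‖A‖²·‖X‖` (through the values, `opNorm_le_bound` twice). [folklore] -/
theorem norm_hess_le (A : EuclideanSpace ℝ ι' →L[ℝ] EuclideanSpace ℝ ι) (X : EuclideanSpace ℝ ι →L[ℝ] EuclideanSpace ℝ ι →L[ℝ] ℝ) :
    ‖((ContinuousLinearMap.compL ℝ (EuclideanSpace ℝ ι') (EuclideanSpace ℝ ι) ℝ).flip A).comp (X.comp A)‖ ≤ ‖A‖ ^ 2 * ‖X‖ := by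
  refine ContinuousLinearMap.opNorm_le_bound _ (by positivity) fun h => ?_
  refine ContinuousLinearMap.opNorm_le_bound _ (by positivity) fun k => ?_
  rw [hess_apply]
  calc ‖X (A h) (A k)‖ ≤ ‖X (A h)‖ * ‖A k‖ := (X (A h)).le_opNorm _
    _ ≤ (‖X‖ * ‖A h‖) * ‖A k‖ := by gcongr; exact X.le_opNorm _
    _ ≤ (‖X‖ * (‖A‖ * ‖h‖)) * (‖A‖ * ‖k‖) := by gcongr <;> exact A.le_opNorm _
    _ = ‖A‖ ^ 2 * ‖X‖ * ‖h‖ * ‖k‖ := by ring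

/-- `‖Ψ_A ∘ T ∘ A‖ ≤ ‖A‖³·‖T‖` (through the values, `opNorm_le_bound` thrice). [folklore] -/
theorem norm_third_le (A : EuclideanSpace ℝ ι' →L[ℝ] EuclideanSpace ℝ ι)
    (T : EuclideanSpace ℝ ι →L[ℝ] EuclideanSpace ℝ ι →L[ℝ] EuclideanSpace ℝ ι →L[ℝ] ℝ) :
    ‖((ContinuousLinearMap.compL ℝ (EuclideanSpace ℝ ι') (EuclideanSpace ℝ ι →L[ℝ] ℝ) (EuclideanSpace ℝ ι' →L[ℝ] ℝ)
        ((ContinuousLinearMap.compL ℝ (EuclideanSpace ℝ ι') (EuclideanSpace ℝ ι) ℝ).flip A)).comp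
        ((ContinuousLinearMap.compL ℝ (EuclideanSpace ℝ ι') (EuclideanSpace ℝ ι) (EuclideanSpace ℝ ι →L[ℝ] ℝ)).flip A)).comp (T.comp A)‖ ≤
      ‖A‖ ^ 3 * ‖T‖ := by
  refine ContinuousLinearMap.opNorm_le_bound _ (by positivity) fun h => ?_
  refine ContinuousLinearMap.opNorm_le_bound _ (by positivity) fun k => ?_
  refine ContinuousLinearMap.opNorm_le_bound _ (by positivity) fun l => ?_
  rw [third_apply]
  calc ‖T (A h) (A k) (A l)‖ ≤ ‖T (A h) (A k)‖ * ‖A l‖ := (T (A h) (A k)).le_opNorm _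
    _ ≤ (‖T (A h)‖ * ‖A k‖) * ‖A l‖ := by gcongr; exact (T (A h)).le_opNorm _
    _ ≤ ((‖T‖ * ‖A h‖) * ‖A k‖) * ‖A l‖ := by gcongr; exact T.le_opNorm _
    _ ≤ ((‖T‖ * (‖A‖ * ‖h‖)) * (‖A‖ * ‖k‖)) * (‖A‖ * ‖l‖) := by gcongr <;> exact A.le_opNorm _
    _ = ‖A‖ ^ 3 * ‖T‖ * ‖h‖ * ‖k‖ * ‖l‖ := by ring

/-! ## §2. Chain rules: the rescaled potential is `C³` with the transported derivative maps -/

/-- **`U ∘ A` is differentiable with derivative `U′(Av) ∘ A`.** [folklore] -/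
theorem hasFDerivAt_comp (hUd : ∀ φ : EuclideanSpace ℝ ι, HasFDerivAt U (U' φ) φ) (v : EuclideanSpace ℝ ι') :
    HasFDerivAt (fun v : EuclideanSpace ℝ ι' => U (A v)) ((U' (A v)).comp A) v :=
  (hUd (A v)).comp v A.hasFDerivAt

/-- **The derivative map `v ↦ U′(Av) ∘ A` has derivative `P_A ∘ U″(Av) ∘ A`.** [folklore] -/
theorem hasFDerivAt_grad_comp (hU'd : ∀ φ : EuclideanSpace ℝ ι, HasFDerivAt U' (U'' φ) φ) (v : EuclideanSpace ℝ ι') :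
    HasFDerivAt (fun v : EuclideanSpace ℝ ι' => (U' (A v)).comp A)
      (((ContinuousLinearMap.compL ℝ (EuclideanSpace ℝ ι') (EuclideanSpace ℝ ι) ℝ).flip A).comp ((U'' (A v)).comp A)) v := by
  have h1 : HasFDerivAt (fun v : EuclideanSpace ℝ ι' => U' (A v)) ((U'' (A v)).comp A) v := (hU'd (A v)).comp v A.hasFDerivAt
  have h2 := ((ContinuousLinearMap.compL ℝ (EuclideanSpace ℝ ι') (EuclideanSpace ℝ ι) ℝ).flip A).hasFDerivAt.comp v h1
  have hfun : (fun v : EuclideanSpace ℝ ι' => (U' (A v)).comp A) =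
      (⇑((ContinuousLinearMap.compL ℝ (EuclideanSpace ℝ ι') (EuclideanSpace ℝ ι) ℝ).flip A) ∘ fun v : EuclideanSpace ℝ ι' => U' (A v)) := by
    funext w
    simp only [Function.comp_apply, precomp_apply]
  rw [hfun]
  exact h2

/-- **The Hessian map `v ↦ P_A ∘ U″(Av) ∘ A` has derivative `Ψ_A ∘ U‴(Av) ∘ A`.** [folklore] -/
theorem hasFDerivAt_hess_comp (hU''d : ∀ φ : EuclideanSpace ℝ ι, HasFDerivAt U'' (U₃ φ) φ) (v : EuclideanSpace ℝ ι') :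
    HasFDerivAt (fun v : EuclideanSpace ℝ ι' => ((ContinuousLinearMap.compL ℝ (EuclideanSpace ℝ ι') (EuclideanSpace ℝ ι) ℝ).flip A).comp ((U'' (A v)).comp A))
      (((ContinuousLinearMap.compL ℝ (EuclideanSpace ℝ ι') (EuclideanSpace ℝ ι →L[ℝ] ℝ) (EuclideanSpace ℝ ι' →L[ℝ] ℝ)
        ((ContinuousLinearMap.compL ℝ (EuclideanSpace ℝ ι') (EuclideanSpace ℝ ι) ℝ).flip A)).comp
        ((ContinuousLinearMap.compL ℝ (EuclideanSpace ℝ ι') (EuclideanSpace ℝ ι) (EuclideanSpace ℝ ι →L[ℝ] ℝ)).flip A)).comp ((U₃ (A v)).comp A)) v := by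
  have h1 : HasFDerivAt (fun v : EuclideanSpace ℝ ι' => U'' (A v)) ((U₃ (A v)).comp A) v := (hU''d (A v)).comp v A.hasFDerivAt
  have h2 := ((ContinuousLinearMap.compL ℝ (EuclideanSpace ℝ ι') (EuclideanSpace ℝ ι →L[ℝ] ℝ) (EuclideanSpace ℝ ι' →L[ℝ] ℝ)
        ((ContinuousLinearMap.compL ℝ (EuclideanSpace ℝ ι') (EuclideanSpace ℝ ι) ℝ).flip A)).comp
        ((ContinuousLinearMap.compL ℝ (EuclideanSpace ℝ ι') (EuclideanSpace ℝ ι) (EuclideanSpace ℝ ι →L[ℝ] ℝ)).flip A)).hasFDerivAt.comp v h1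
  have hfun : (fun v : EuclideanSpace ℝ ι' => ((ContinuousLinearMap.compL ℝ (EuclideanSpace ℝ ι') (EuclideanSpace ℝ ι) ℝ).flip A).comp ((U'' (A v)).comp A)) =
      (⇑((ContinuousLinearMap.compL ℝ (EuclideanSpace ℝ ι') (EuclideanSpace ℝ ι →L[ℝ] ℝ) (EuclideanSpace ℝ ι' →L[ℝ] ℝ)
        ((ContinuousLinearMap.compL ℝ (EuclideanSpace ℝ ι') (EuclideanSpace ℝ ι) ℝ).flip A)).comp
        ((ContinuousLinearMap.compL ℝ (EuclideanSpace ℝ ι') (EuclideanSpace ℝ ι) (EuclideanSpace ℝ ι →L[ℝ] ℝ)).flip A)) ∘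
        fun v : EuclideanSpace ℝ ι' => U'' (A v)) := by
    funext w
    simp only [Function.comp_apply, hessTransport_apply]
  rw [hfun]
  exact h2

/-- Continuity of the derivative map `v ↦ U′(Av) ∘ A`. [folklore] -/
theorem continuous_grad_comp (hU'c : Continuous U') : Continuous fun v : EuclideanSpace ℝ ι' => (U' (A v)).comp A :=
  (hU'c.comp A.continuous).clm_comp_const A

/-- Continuity of the Hessian map `v ↦ P_A ∘ U″(Av) ∘ A`. [folklore] -/
theorem continuous_hess_comp (hU''c : Continuous U'') :
    Continuous fun v : EuclideanSpace ℝ ι' => ((ContinuousLinearMap.compL ℝ (EuclideanSpace ℝ ι') (EuclideanSpace ℝ ι) ℝ).flip A).comp ((U'' (A v)).comp A) :=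
  ((hU''c.comp A.continuous).clm_comp_const A).const_clm_comp _

/-- Continuity of the third-derivative map `v ↦ Ψ_A ∘ U‴(Av) ∘ A`. [folklore] -/
theorem continuous_third_comp (hU₃c : Continuous U₃) :
    Continuous fun v : EuclideanSpace ℝ ι' => ((ContinuousLinearMap.compL ℝ (EuclideanSpace ℝ ι') (EuclideanSpace ℝ ι →L[ℝ] ℝ) (EuclideanSpace ℝ ι' →L[ℝ] ℝ)
        ((ContinuousLinearMap.compL ℝ (EuclideanSpace ℝ ι') (EuclideanSpace ℝ ι) ℝ).flip A)).comp
        ((ContinuousLinearMap.compL ℝ (EuclideanSpace ℝ ι') (EuclideanSpace ℝ ι) (EuclideanSpace ℝ ι →L[ℝ] ℝ)).flip A)).comp ((U₃ (A v)).comp A) :=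
  ((hU₃c.comp A.continuous).clm_comp_const A).const_clm_comp _

/-! ## §3. Block transfer -/

/-- `Σ_i (Az)_i² ≤ ‖A‖²·Σ_{i′} z_{i′}²` (the Euclidean norms). [folklore] -/
theorem sum_sq_map_le (A : EuclideanSpace ℝ ι' →L[ℝ] EuclideanSpace ℝ ι) (z : EuclideanSpace ℝ ι') :
    ∑ i, (A z) i ^ 2 ≤ ‖A‖ ^ 2 * ∑ i', z i' ^ 2 := by
  rw [← EuclideanSpace.real_norm_sq_eq, ← EuclideanSpace.real_norm_sq_eq, ← mul_pow]
  exact pow_le_pow_left₀ (norm_nonneg _) (A.le_opNorm z) 2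

omit [Fintype ι] [Fintype ι'] in
/-- `A((1−s)a + sb) = (1−s)Aa + sAb`. [folklore] -/
theorem map_convex_comb (A : EuclideanSpace ℝ ι' →L[ℝ] EuclideanSpace ℝ ι) (s : ℝ) (a b : EuclideanSpace ℝ ι') :
    A ((1 - s) • a + s • b) = (1 - s) • A a + s • A b := by
  rw [map_add, map_smul, map_smul]

/-! ## §4. The letters of `U ∘ A` on `Y′` -/

omit [Fintype ι] [Fintype ι'] in
/-- **LOCALITY is transported**: if `A` is local from `Y′` to `Y` (`v = v′` on `Y′ ⟹ Av = Av′` on `Y`) and `U` is `Y`-local, then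
`U ∘ A` is `Y′`-local. [folklore] -/
theorem local_comp (Y : Finset ι) (Y' : Finset ι')
    (hAloc : ∀ v v' : EuclideanSpace ℝ ι', (∀ y ∈ Y', v y = v' y) → ∀ x ∈ Y, (A v) x = (A v') x)
    (hUloc : ∀ φ φ' : EuclideanSpace ℝ ι, (∀ x ∈ Y, φ x = φ' x) → U φ = U φ') :
    ∀ v v' : EuclideanSpace ℝ ι', (∀ y ∈ Y', v y = v' y) → U (A v) = U (A v') :=
  fun v v' hv => hUloc (A v) (A v') (hAloc v v' hv)

omit [Fintype ι] [Fintype ι'] in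
/-- **THE STABILITY LETTER**: `−κ₀Σ_Yφ² ≤ U` and the block transfer `Σ_Y(Av)² ≤ cΣ_{Y′}v²` (`κ₀ ≥ 0`) give `−(cκ₀)Σ_{Y′}v² ≤ U(Av)`. [folklore] -/
theorem stab_comp (Y : Finset ι) (Y' : Finset ι') (hAY : ∀ v : EuclideanSpace ℝ ι', ∑ x ∈ Y, (A v) x ^ 2 ≤ c * ∑ y ∈ Y', v y ^ 2)
    (hκ₀ : 0 ≤ κ₀) (hstab : ∀ φ : EuclideanSpace ℝ ι, -(κ₀ * ∑ x ∈ Y, φ x ^ 2) ≤ U φ) :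
    ∀ v : EuclideanSpace ℝ ι', -((c * κ₀) * ∑ y ∈ Y', v y ^ 2) ≤ U (A v) := by
  intro v
  have h1 := hstab (A v)
  have h2 : κ₀ * ∑ x ∈ Y, (A v) x ^ 2 ≤ κ₀ * (c * ∑ y ∈ Y', v y ^ 2) := mul_le_mul_of_nonneg_left (hAY v) hκ₀
  linarith

/-- **THE GRADIENT LETTER, raw form**: `‖(U∘A)′v‖ ≤ ‖A‖κ₁(a + cΣ_{Y′}v²)` (`κ₁ ≥ 0`). [folklore] -/
theorem grad_letter_comp_raw (Y : Finset ι) (Y' : Finset ι') (hAY : ∀ v : EuclideanSpace ℝ ι', ∑ x ∈ Y, (A v) x ^ 2 ≤ c * ∑ y ∈ Y', v y ^ 2)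
    (hκ₁ : 0 ≤ κ₁) (hU'b : ∀ φ : EuclideanSpace ℝ ι, ‖U' φ‖ ≤ κ₁ * (a + ∑ x ∈ Y, φ x ^ 2)) :
    ∀ v : EuclideanSpace ℝ ι', ‖(U' (A v)).comp A‖ ≤ ‖A‖ * κ₁ * (a + c * ∑ y ∈ Y', v y ^ 2) := by
  intro v
  calc ‖(U' (A v)).comp A‖ ≤ ‖A‖ * ‖U' (A v)‖ := norm_grad_le A _
    _ ≤ ‖A‖ * (κ₁ * (a + ∑ x ∈ Y, (A v) x ^ 2)) := by gcongr; exact hU'b (A v)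
    _ ≤ ‖A‖ * (κ₁ * (a + c * ∑ y ∈ Y', v y ^ 2)) := by gcongr; exact hAY v
    _ = ‖A‖ * κ₁ * (a + c * ∑ y ∈ Y', v y ^ 2) := by ring

/-- **THE GRADIENT LETTER in the input format**: `‖(U∘A)′v‖ ≤ (‖A‖κ₁max(1,c))·(a + Σ_{Y′}v²)` (`κ₁, a ≥ 0`). [folklore] -/
theorem grad_letter_comp (Y : Finset ι) (Y' : Finset ι') (hAY : ∀ v : EuclideanSpace ℝ ι', ∑ x ∈ Y, (A v) x ^ 2 ≤ c * ∑ y ∈ Y', v y ^ 2)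
    (hκ₁ : 0 ≤ κ₁) (ha : 0 ≤ a) (hU'b : ∀ φ : EuclideanSpace ℝ ι, ‖U' φ‖ ≤ κ₁ * (a + ∑ x ∈ Y, φ x ^ 2)) :
    ∀ v : EuclideanSpace ℝ ι', ‖(U' (A v)).comp A‖ ≤ ‖A‖ * κ₁ * max 1 c * (a + ∑ y ∈ Y', v y ^ 2) := by
  intro v
  have h1 := grad_letter_comp_raw Y Y' hAY hκ₁ hU'b v
  have hS : 0 ≤ ∑ y ∈ Y', v y ^ 2 := Finset.sum_nonneg fun y _ => sq_nonneg _
  have hm1 : (1 : ℝ) ≤ max 1 c := le_max_left _ _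
  have hmc : c ≤ max 1 c := le_max_right _ _
  have hAκ : 0 ≤ ‖A‖ * κ₁ := mul_nonneg (norm_nonneg _) hκ₁
  have h2 : a + c * ∑ y ∈ Y', v y ^ 2 ≤ max 1 c * (a + ∑ y ∈ Y', v y ^ 2) := by
    have : a ≤ max 1 c * a := by nlinarith
    nlinarith [mul_le_mul_of_nonneg_right hmc hS]
  calc ‖(U' (A v)).comp A‖ ≤ ‖A‖ * κ₁ * (a + c * ∑ y ∈ Y', v y ^ 2) := h1
    _ ≤ ‖A‖ * κ₁ * (max 1 c * (a + ∑ y ∈ Y', v y ^ 2)) := mul_le_mul_of_nonneg_left h2 hAκ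
    _ = ‖A‖ * κ₁ * max 1 c * (a + ∑ y ∈ Y', v y ^ 2) := by ring

/-- **THE HESSIAN LETTER**: `‖(U∘A)″v‖ ≤ ‖A‖²κ₂`. [folklore] -/
theorem hess_letter_comp (hU''b : ∀ φ : EuclideanSpace ℝ ι, ‖U'' φ‖ ≤ κ₂) :
    ∀ v : EuclideanSpace ℝ ι', ‖((ContinuousLinearMap.compL ℝ (EuclideanSpace ℝ ι') (EuclideanSpace ℝ ι) ℝ).flip A).comp ((U'' (A v)).comp A)‖ ≤ ‖A‖ ^ 2 * κ₂ :=
  fun v => (norm_hess_le A _).trans (mul_le_mul_of_nonneg_left (hU''b (A v)) (by positivity))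

/-- **THE THIRD-DERIVATIVE LETTER**: `‖(U∘A)‴v‖ ≤ ‖A‖³κ₃`. [folklore] -/
theorem third_letter_comp (hU₃b : ∀ φ : EuclideanSpace ℝ ι, ‖U₃ φ‖ ≤ κ₃) :
    ∀ v : EuclideanSpace ℝ ι', ‖((ContinuousLinearMap.compL ℝ (EuclideanSpace ℝ ι') (EuclideanSpace ℝ ι →L[ℝ] ℝ) (EuclideanSpace ℝ ι' →L[ℝ] ℝ)
        ((ContinuousLinearMap.compL ℝ (EuclideanSpace ℝ ι') (EuclideanSpace ℝ ι) ℝ).flip A)).comp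
        ((ContinuousLinearMap.compL ℝ (EuclideanSpace ℝ ι') (EuclideanSpace ℝ ι) (EuclideanSpace ℝ ι →L[ℝ] ℝ)).flip A)).comp ((U₃ (A v)).comp A)‖ ≤
      ‖A‖ ^ 3 * κ₃ :=
  fun v => (norm_third_le A _).trans (mul_le_mul_of_nonneg_left (hU₃b (A v)) (by positivity))

omit [Fintype ι] [Fintype ι'] in
/-- **THE GROWTH LETTER**: `U ≤ κu(au + Σ_Yφ²)` (`κu, au ≥ 0`) gives `U(Av) ≤ (κu·max(1,c))(au + Σ_{Y′}v²)`. [folklore] -/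
theorem growth_comp (Y : Finset ι) (Y' : Finset ι') (hAY : ∀ v : EuclideanSpace ℝ ι', ∑ x ∈ Y, (A v) x ^ 2 ≤ c * ∑ y ∈ Y', v y ^ 2)
    (hκu : 0 ≤ κu) (hau : 0 ≤ au) (hUup : ∀ φ : EuclideanSpace ℝ ι, U φ ≤ κu * (au + ∑ x ∈ Y, φ x ^ 2)) :
    ∀ v : EuclideanSpace ℝ ι', U (A v) ≤ κu * max 1 c * (au + ∑ y ∈ Y', v y ^ 2) := by
  intro v
  have hS : 0 ≤ ∑ y ∈ Y', v y ^ 2 := Finset.sum_nonneg fun y _ => sq_nonneg _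
  have hm1 : (1 : ℝ) ≤ max 1 c := le_max_left _ _
  have hmc : c ≤ max 1 c := le_max_right _ _
  have h2 : au + c * ∑ y ∈ Y', v y ^ 2 ≤ max 1 c * (au + ∑ y ∈ Y', v y ^ 2) := by
    have : au ≤ max 1 c * au := by nlinarith
    nlinarith [mul_le_mul_of_nonneg_right hmc hS]
  calc U (A v) ≤ κu * (au + ∑ x ∈ Y, (A v) x ^ 2) := hUup (A v)
    _ ≤ κu * (au + c * ∑ y ∈ Y', v y ^ 2) := by gcongr; exact hAY v
    _ ≤ κu * (max 1 c * (au + ∑ y ∈ Y', v y ^ 2)) := mul_le_mul_of_nonneg_left h2 hκu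
    _ = κu * max 1 c * (au + ∑ y ∈ Y', v y ^ 2) := by ring

omit [Fintype ι] [Fintype ι'] in
/-- **THE TWO-POINT UPPER LETTER**: `U(φ′) ≤ U(φ) + U′φ(φ′−φ) + ½ΛΣ_Y(φ′−φ)²` (`Λ ≥ 0`) gives the same for `U ∘ A` on `Y′` with `cΛ`. [folklore] -/
theorem upper_letter_comp (Y : Finset ι) (Y' : Finset ι') (hAY : ∀ v : EuclideanSpace ℝ ι', ∑ x ∈ Y, (A v) x ^ 2 ≤ c * ∑ y ∈ Y', v y ^ 2)
    (hΛ : 0 ≤ Λ) (hwup : ∀ φ φ' : EuclideanSpace ℝ ι, U φ' ≤ U φ + U' φ (φ' - φ) + Λ / 2 * ∑ x ∈ Y, (φ' x - φ x) ^ 2) :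
    ∀ v v' : EuclideanSpace ℝ ι', U (A v') ≤ U (A v) + ((U' (A v)).comp A) (v' - v) + (c * Λ) / 2 * ∑ y ∈ Y', (v' y - v y) ^ 2 := by
  intro v v'
  have h1 := hwup (A v) (A v')
  have hsub : ∀ x, (A v') x - (A v) x = (A (v' - v)) x := fun x => by rw [map_sub]; rfl
  have hsub' : ∀ y, v' y - v y = (v' - v) y := fun y => rfl
  simp only [hsub] at h1
  simp only [hsub']
  have h2 : Λ / 2 * ∑ x ∈ Y, (A (v' - v)) x ^ 2 ≤ Λ / 2 * (c * ∑ y ∈ Y', (v' - v) y ^ 2) :=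
    mul_le_mul_of_nonneg_left (hAY (v' - v)) (by positivity)
  have h3 : ((U' (A v)).comp A) (v' - v) = U' (A v) (A v' - A v) := by rw [ContinuousLinearMap.comp_apply, map_sub]
  rw [h3]
  linarith

/-- **THE SECANT LOWER LETTER**: the semiconvexity defect `λ ≥ 0` of `U` (in the full `Σ_i` format) becomes `‖A‖²λ` for `U ∘ A`. [folklore] -/
theorem secant_letter_comp (hlam : 0 ≤ lam)
    (hUsec : ∀ s : ℝ, 0 ≤ s → s ≤ 1 → ∀ a b : EuclideanSpace ℝ ι,
      U ((1 - s) • a + s • b) - lam / 2 * (s * (1 - s)) * ∑ i, (a i - b i) ^ 2 ≤ (1 - s) * U a + s * U b) :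
    ∀ s : ℝ, 0 ≤ s → s ≤ 1 → ∀ a b : EuclideanSpace ℝ ι',
      U (A ((1 - s) • a + s • b)) - (‖A‖ ^ 2 * lam) / 2 * (s * (1 - s)) * ∑ i', (a i' - b i') ^ 2 ≤ (1 - s) * U (A a) + s * U (A b) := by
  intro s hs0 hs1 a b
  have h1 := hUsec s hs0 hs1 (A a) (A b)
  rw [map_convex_comb]
  have hsub : ∀ i, (A a) i - (A b) i = (A (a - b)) i := fun i => by rw [map_sub]; rfl
  have hsub' : ∀ i', a i' - b i' = (a - b) i' := fun i' => rfl
  simp only [hsub] at h1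
  simp only [hsub']
  have h2 : ∑ i, (A (a - b)) i ^ 2 ≤ ‖A‖ ^ 2 * ∑ i', (a - b) i' ^ 2 := sum_sq_map_le A (a - b)
  have hss : 0 ≤ lam / 2 * (s * (1 - s)) := by
    have : 0 ≤ s * (1 - s) := mul_nonneg hs0 (by linarith)
    positivity
  have h3 : lam / 2 * (s * (1 - s)) * ∑ i, (A (a - b)) i ^ 2 ≤ lam / 2 * (s * (1 - s)) * (‖A‖ ^ 2 * ∑ i', (a - b) i' ^ 2) :=
    mul_le_mul_of_nonneg_left h2 hss
  have h4 : (‖A‖ ^ 2 * lam) / 2 * (s * (1 - s)) * ∑ i', (a - b) i' ^ 2 = lam / 2 * (s * (1 - s)) * (‖A‖ ^ 2 * ∑ i', (a - b) i' ^ 2) := by ring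
  rw [h4]
  linarith

/-! ## §5. The end: the input block of (427) for `U ∘ A` on `Y′`, assembled -/

/-- **THE RESCALED CLASS, STRUCTURE HALF**: for a `Y`-local `C³` input `U` and a continuous linear `A` local from `Y′` to `Y`, the
potential `U ∘ A` is `Y′`-local and `C³` with the derivative maps `U′(Av) ∘ A`, `P_A ∘ U″(Av) ∘ A`, `Ψ_A ∘ U‴(Av) ∘ A` (HasFDerivAt at
every point, all three continuous) — the hypotheses `hUloc, hUd, hU'c, hU'd, hU''c, hU''d, hU₃c` of the input format, regenerated. [folklore] -/
theorem rescaled_class_structure (Y : Finset ι) (Y' : Finset ι')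
    (hAloc : ∀ v v' : EuclideanSpace ℝ ι', (∀ y ∈ Y', v y = v' y) → ∀ x ∈ Y, (A v) x = (A v') x)
    (hUloc : ∀ φ φ' : EuclideanSpace ℝ ι, (∀ x ∈ Y, φ x = φ' x) → U φ = U φ')
    (hUd : ∀ φ : EuclideanSpace ℝ ι, HasFDerivAt U (U' φ) φ) (hU'd : ∀ φ : EuclideanSpace ℝ ι, HasFDerivAt U' (U'' φ) φ)
    (hU''d : ∀ φ : EuclideanSpace ℝ ι, HasFDerivAt U'' (U₃ φ) φ) (hU₃c : Continuous U₃) :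
    (∀ v v' : EuclideanSpace ℝ ι', (∀ y ∈ Y', v y = v' y) → U (A v) = U (A v')) ∧
    (∀ v : EuclideanSpace ℝ ι', HasFDerivAt (fun v : EuclideanSpace ℝ ι' => U (A v)) ((U' (A v)).comp A) v) ∧
    (Continuous fun v : EuclideanSpace ℝ ι' => (U' (A v)).comp A) ∧
    (∀ v : EuclideanSpace ℝ ι', HasFDerivAt (fun v : EuclideanSpace ℝ ι' => (U' (A v)).comp A)
      (((ContinuousLinearMap.compL ℝ (EuclideanSpace ℝ ι') (EuclideanSpace ℝ ι) ℝ).flip A).comp ((U'' (A v)).comp A)) v) ∧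
    (Continuous fun v : EuclideanSpace ℝ ι' => ((ContinuousLinearMap.compL ℝ (EuclideanSpace ℝ ι') (EuclideanSpace ℝ ι) ℝ).flip A).comp ((U'' (A v)).comp A)) ∧
    (∀ v : EuclideanSpace ℝ ι', HasFDerivAt
      (fun v : EuclideanSpace ℝ ι' => ((ContinuousLinearMap.compL ℝ (EuclideanSpace ℝ ι') (EuclideanSpace ℝ ι) ℝ).flip A).comp ((U'' (A v)).comp A))
      (((ContinuousLinearMap.compL ℝ (EuclideanSpace ℝ ι') (EuclideanSpace ℝ ι →L[ℝ] ℝ) (EuclideanSpace ℝ ι' →L[ℝ] ℝ)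
        ((ContinuousLinearMap.compL ℝ (EuclideanSpace ℝ ι') (EuclideanSpace ℝ ι) ℝ).flip A)).comp
        ((ContinuousLinearMap.compL ℝ (EuclideanSpace ℝ ι') (EuclideanSpace ℝ ι) (EuclideanSpace ℝ ι →L[ℝ] ℝ)).flip A)).comp ((U₃ (A v)).comp A)) v) ∧
    (Continuous fun v : EuclideanSpace ℝ ι' => ((ContinuousLinearMap.compL ℝ (EuclideanSpace ℝ ι') (EuclideanSpace ℝ ι →L[ℝ] ℝ) (EuclideanSpace ℝ ι' →L[ℝ] ℝ)
        ((ContinuousLinearMap.compL ℝ (EuclideanSpace ℝ ι') (EuclideanSpace ℝ ι) ℝ).flip A)).comp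
        ((ContinuousLinearMap.compL ℝ (EuclideanSpace ℝ ι') (EuclideanSpace ℝ ι) (EuclideanSpace ℝ ι →L[ℝ] ℝ)).flip A)).comp ((U₃ (A v)).comp A)) := by
  have hU'c : Continuous U' := continuous_iff_continuousAt.2 fun φ => (hU'd φ).continuousAt
  have hU''c : Continuous U'' := continuous_iff_continuousAt.2 fun φ => (hU''d φ).continuousAt
  exact ⟨local_comp Y Y' hAloc hUloc, hasFDerivAt_comp hUd, continuous_grad_comp hU'c, hasFDerivAt_grad_comp hU'd, continuous_hess_comp hU''c,
    hasFDerivAt_hess_comp hU''d, continuous_third_comp hU₃c⟩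

/-- **THE RESCALED CLASS, LETTER HALF — THE RESCALING LETTER MAP**: with the block transfer constant `c` of `A` from `Y′` to `Y` and
the operator norm `‖A‖`, the seven inequality letters of the input format hold for `U ∘ A` on `Y′` with
`(κ₀, κ₁, a, κ₂, κ₃, κu, au, Λ, λ) ↦ (cκ₀, ‖A‖κ₁max(1,c), a, ‖A‖²κ₂, ‖A‖³κ₃, κu·max(1,c), au, cΛ, ‖A‖²λ)`. [folklore] -/
theorem rescaled_class_letters (Y : Finset ι) (Y' : Finset ι') (hAY : ∀ v : EuclideanSpace ℝ ι', ∑ x ∈ Y, (A v) x ^ 2 ≤ c * ∑ y ∈ Y', v y ^ 2)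
    (hκ₀ : 0 ≤ κ₀) (hκ₁ : 0 ≤ κ₁) (ha : 0 ≤ a) (hκu : 0 ≤ κu) (hau : 0 ≤ au) (hΛ : 0 ≤ Λ) (hlam : 0 ≤ lam)
    (hstab : ∀ φ : EuclideanSpace ℝ ι, -(κ₀ * ∑ x ∈ Y, φ x ^ 2) ≤ U φ)
    (hU'b : ∀ φ : EuclideanSpace ℝ ι, ‖U' φ‖ ≤ κ₁ * (a + ∑ x ∈ Y, φ x ^ 2)) (hU''b : ∀ φ : EuclideanSpace ℝ ι, ‖U'' φ‖ ≤ κ₂)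
    (hU₃b : ∀ φ : EuclideanSpace ℝ ι, ‖U₃ φ‖ ≤ κ₃) (hUup : ∀ φ : EuclideanSpace ℝ ι, U φ ≤ κu * (au + ∑ x ∈ Y, φ x ^ 2))
    (hwup : ∀ φ φ' : EuclideanSpace ℝ ι, U φ' ≤ U φ + U' φ (φ' - φ) + Λ / 2 * ∑ x ∈ Y, (φ' x - φ x) ^ 2)
    (hUsec : ∀ s : ℝ, 0 ≤ s → s ≤ 1 → ∀ a b : EuclideanSpace ℝ ι,
      U ((1 - s) • a + s • b) - lam / 2 * (s * (1 - s)) * ∑ i, (a i - b i) ^ 2 ≤ (1 - s) * U a + s * U b) :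
    (∀ v : EuclideanSpace ℝ ι', -((c * κ₀) * ∑ y ∈ Y', v y ^ 2) ≤ U (A v)) ∧
    (∀ v : EuclideanSpace ℝ ι', ‖(U' (A v)).comp A‖ ≤ ‖A‖ * κ₁ * max 1 c * (a + ∑ y ∈ Y', v y ^ 2)) ∧
    (∀ v : EuclideanSpace ℝ ι', ‖((ContinuousLinearMap.compL ℝ (EuclideanSpace ℝ ι') (EuclideanSpace ℝ ι) ℝ).flip A).comp ((U'' (A v)).comp A)‖ ≤ ‖A‖ ^ 2 * κ₂) ∧
    (∀ v : EuclideanSpace ℝ ι', ‖((ContinuousLinearMap.compL ℝ (EuclideanSpace ℝ ι') (EuclideanSpace ℝ ι →L[ℝ] ℝ) (EuclideanSpace ℝ ι' →L[ℝ] ℝ)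
        ((ContinuousLinearMap.compL ℝ (EuclideanSpace ℝ ι') (EuclideanSpace ℝ ι) ℝ).flip A)).comp
        ((ContinuousLinearMap.compL ℝ (EuclideanSpace ℝ ι') (EuclideanSpace ℝ ι) (EuclideanSpace ℝ ι →L[ℝ] ℝ)).flip A)).comp ((U₃ (A v)).comp A)‖ ≤
      ‖A‖ ^ 3 * κ₃) ∧
    (∀ v : EuclideanSpace ℝ ι', U (A v) ≤ κu * max 1 c * (au + ∑ y ∈ Y', v y ^ 2)) ∧
    (∀ v v' : EuclideanSpace ℝ ι', U (A v') ≤ U (A v) + ((U' (A v)).comp A) (v' - v) + (c * Λ) / 2 * ∑ y ∈ Y', (v' y - v y) ^ 2) ∧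
    (∀ s : ℝ, 0 ≤ s → s ≤ 1 → ∀ a b : EuclideanSpace ℝ ι',
      U (A ((1 - s) • a + s • b)) - (‖A‖ ^ 2 * lam) / 2 * (s * (1 - s)) * ∑ i', (a i' - b i') ^ 2 ≤ (1 - s) * U (A a) + s * U (A b)) :=
  ⟨stab_comp Y Y' hAY hκ₀ hstab, grad_letter_comp Y Y' hAY hκ₁ ha hU'b, hess_letter_comp hU''b, third_letter_comp hU₃b,
    growth_comp Y Y' hAY hκu hau hUup, upper_letter_comp Y Y' hAY hΛ hwup, secant_letter_comp hlam hUsec⟩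

/-! ## §6. Toy -/

/-- Toy (kernel): `A = 0` has block transfer constant `c = 0`, so the stability letter of `U ∘ 0` on any `Y′` is `0 ≤ U 0` given
`−κ₀Σ_Yφ² ≤ U`. -/
example (Y : Finset ι) (Y' : Finset ι') (hκ₀ : 0 ≤ κ₀) (hstab : ∀ φ : EuclideanSpace ℝ ι, -(κ₀ * ∑ x ∈ Y, φ x ^ 2) ≤ U φ)
    (v : EuclideanSpace ℝ ι') : -((0 * κ₀) * ∑ y ∈ Y', v y ^ 2) ≤ U ((0 : EuclideanSpace ℝ ι' →L[ℝ] EuclideanSpace ℝ ι) v) := by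
  refine stab_comp (A := 0) (c := 0) Y Y' (fun v => ?_) hκ₀ hstab v
  simp

end Summit.QuantumFields.BalabanUV.T4Continuum.NE7b.SupBlockRescalingLetters

end
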